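import Literature.NumberTheory.DiophantineGeometry.CatalanLocalQthRoot
import Literature.NumberTheory.NumberFields.RelativeNormPositivity
import HarnessLib

/-!
# The unit `η = (w - w')^q` of Schoof's Proposition 8.1 when `ℤ[ζ_p]` is a PID (finite `π`-adic level)

[Schoof2009, Chapter 8] (Theorem 8.3, Corollary 8.4): when `q ∤ h_p⁻`, a non-zero solution of
`x^p - y^q = 1` makes the minus component `(x - ζ_p)^{1-ι}` a `q`-th power `α^q`, and then the
number `η = (w - w')^q`, `w^q = (x - ζ_p)/(1 - ζ_p)`, `w' = w/α`, is a unit of norm `1`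
(Proposition 8.1) whose `π`-adic expansion leads to a contradiction (Proposition 8.2, Theorem 8.3).
This file provides `η` together with finite-level `q`-th roots `w, w'` in `ℤ[ζ_p]` in the case where
`ℤ[ζ_p]` is a principal ideal domain (`h_p = 1`, e.g. `p = 3, 5`: Mathlib's `three_pid`, `five_pid`)
and `q ∤ p - 1`:

* `Catalan.exists_unit_norm_one_and_roots` — for every `M` there are a unit `η` with
  `N_{K/ℚ}(η) = 1` and `w, w' ∈ 𝓞 K` with `w^q ≡ 1 + μ`, `w'^q ≡ μ - ζ⁻¹` and
  `(w - w')^q ≡ η (mod π^M)`, where `μ = (x - 1)/(1 - ζ)` (so `1 + μ = (x - ζ)/(1 - ζ)` and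
  `μ - ζ⁻¹ = (x - ζ̄)/(1 - ζ)`).

Proof ([Schoof2009, Prop. 8.1 and proof of Cor. 8.4]): `(x - ζ) = 𝔭 𝔞^q`
(`Catalan.span_sub_zeta_pow_eq`) and `𝔞 = (γ)` give `x - ζ = π ε γ^q`; with `ε = μ₀ ε̄` (`μ₀` a
root of unity, Kronecker / `IsCMField.unitsMulComplexConjInv`) and `ρ^q = -ζ μ₀` one finds from
`(x - ζ) - (x - ζ̄) = ζ̄ - ζ` that `γ̄ - ργ` divides a unit, and
`η := (ργ - γ̄)^q ζ⁻¹ ε̄` works, with `w` a `q`-th root of `1 + μ = -εγ^q` modulo `π^M`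
(`Catalan.exists_pow_sub_dvd`) and `w' = w γ̄ γ⁻¹ ρ⁻¹ (mod π^M)`. The sign of `N(η) = ±1` is `+`
as `K` is totally complex (`NumberFields.embedding_norm_pos_of_totallyPositive`).

Everything is proved; no definitions, no named facts.

## References

* R. Schoof, *Catalan's Conjecture*, Universitext, Springer 2009 [Schoof2009], Lemma 7.1,
  Propositions 7.2, 7.3, 8.1, Corollary 8.4 (book pp. 41–43, 49–50, 52) — held,
  `lit read book:schoof2009-catalan-s-conjecture` (PDF pp. 120–122, 127–130).
-/

namespace Literature.NumberTheory.DiophantineGeometry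

namespace Catalan

open Finset NumberField

open scoped Pointwise

variable {p : ℕ} [hp : Fact p.Prime] {K : Type*} [Field K] [NumberField K]
  [IsCyclotomicExtension {p} ℚ K] {ζ : K}

omit [NumberField K] [IsCyclotomicExtension {p} ℚ K] in
/-- A `p`-th cyclotomic field, `p` an odd prime, has no real embedding. [folklore] -/
theorem isEmpty_ringHom_real (hζ : IsPrimitiveRoot ζ p) (hp2 : p ≠ 2) : IsEmpty (K →+* ℝ) := by
  refine ⟨fun τ => ?_⟩
  have h1 : (τ ζ) ^ p = 1 := by rw [← map_pow, hζ.pow_eq_one, map_one]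
  have h2 : τ ζ = 1 ∨ τ ζ = -1 := by
    have habs : |τ ζ| = 1 := by
      have := congrArg abs h1
      rw [abs_pow, abs_one] at this
      exact (pow_eq_one_iff_of_nonneg (abs_nonneg _) hp.out.ne_zero).mp this
    rcases abs_eq (zero_le_one) |>.mp habs with h | h
    · exact Or.inl h
    · exact Or.inr h
  have hζ2 : ζ ^ 2 = 1 := by
    apply τ.injective
    rw [map_pow, map_one]
    rcases h2 with h | h <;> rw [h] <;> norm_num
  have := Nat.le_of_dvd two_pos ((hζ.pow_eq_one_iff_dvd 2).mp hζ2)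
  have := hp.out.two_le
  omega

omit [IsCyclotomicExtension {p} ℚ K] in
/-- The norm of a unit of `ℤ[ζ_p]` (`p` odd) is `1`. [cite: Schoof2009, Proposition 8.1 (iii)] -/
theorem norm_eq_one_of_isUnit (hζ : IsPrimitiveRoot ζ p) (hp2 : p ≠ 2) {η : 𝓞 K} (hη : IsUnit η) :
    Algebra.norm ℤ η = 1 := by
  have h1 : IsUnit (Algebra.norm ℤ η) := hη.map _
  rcases Int.isUnit_iff.mp h1 with h | h
  · exact h
  · exfalso
    haveI := isEmpty_ringHom_real hζ hp2
    have hpos := NumberFields.embedding_norm_pos_of_totallyPositive (F := ℚ) (E := K)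
      (x := (η : K)) (RingOfIntegers.coe_ne_zero_iff.mpr hη.ne_zero) (fun τ => isEmptyElim τ)
      (Rat.castHom ℝ)
    rw [← Algebra.coe_norm_int, h] at hpos
    norm_num at hpos

/-- **[Schoof2009, Proposition 8.1 with Corollary 8.4] for `h_p = 1`, at finite `π`-adic level.**
Let `p` be an odd prime with `ℤ[ζ_p]` a PID, `q` an odd prime with `q ≠ p`, `q ∤ p - 1`, and
`x, y` non-zero integers with `x ^ p - y ^ q = 1`; let `μ ∈ 𝓞 K` with `(1 - ζ) μ = x - 1`. Then
for every `M` there are a unit `η` of norm `1` and `w, w' ∈ 𝓞 K` with `w^q ≡ 1 + μ`,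
`w'^q ≡ μ - ζ^(p-1)` and `(w - w')^q ≡ η` modulo `π^M`, `π = ζ - 1`.
[cite: Schoof2009, Proposition 8.1] [cite: Schoof2009, Corollary 8.4] -/
theorem exists_unit_norm_one_and_roots [IsPrincipalIdealRing (𝓞 K)] (hζ : IsPrimitiveRoot ζ p)
    (hpo : Odd p) {q : ℕ} (hq : q.Prime) (hqo : Odd q) (hpq : p ≠ q) (hqp1 : ¬ q ∣ p - 1)
    {x y : ℤ} (hx : x ≠ 0) (hy : y ≠ 0) (h : x ^ p - y ^ q = 1) {μ : 𝓞 K}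
    (hμ : (1 - hζ.toInteger) * μ = x - 1) (M : ℕ) :
    ∃ (η : (𝓞 K)ˣ) (w w' : 𝓞 K), Algebra.norm ℤ (η : 𝓞 K) = 1 ∧
      (hζ.toInteger - 1) ^ M ∣ w ^ q - (1 + μ) ∧
      (hζ.toInteger - 1) ^ M ∣ w' ^ q - (μ - hζ.toInteger ^ (p - 1)) ∧
      (hζ.toInteger - 1) ^ M ∣ (w - w') ^ q - η := by
  classical
  -- ### notation and elementary facts
  have hp2 : p ≠ 2 := fun h2 => by rw [h2] at hpo; exact (Nat.not_even_iff_odd.mpr hpo) even_two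
  have hp3 : 3 ≤ p := by have := hp.out.two_le; omega
  obtain ⟨k, hk⟩ : ∃ k, p = k + 1 := ⟨p - 1, by have := hp.out.one_lt; omega⟩
  have hkp : p - 1 = k := by omega
  rw [hkp]
  have hcop2p : q.Coprime (2 * p) := by
    refine Nat.Coprime.mul_right ?_ ?_
    · exact (Nat.coprime_primes hq Nat.prime_two).mpr fun h2 => by
        subst h2; exact (Nat.not_even_iff_odd.mpr hqo) even_two
    · exact (Nat.coprime_primes hq hp.out).mpr (Ne.symm hpq)
  have h2p : 1 < 2 * p := by have := hp.out.one_lt; omega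
  set z : 𝓞 K := hζ.toInteger with hzdef
  have hz : IsPrimitiveRoot z p := hζ.toInteger_isPrimitiveRoot
  have hzp : z ^ p = 1 := hz.pow_eq_one
  have hzk : z ^ k * z = 1 := by rw [← pow_succ, ← hk, hzp]
  set π : 𝓞 K := z - 1 with hπdef
  have hπ : Prime π := by rw [hπdef, hzdef]; exact hζ.zeta_sub_one_prime'
  have h1z : (1 : 𝓞 K) - z ≠ 0 := fun h0 => hπ.ne_zero (by rw [hπdef]; linear_combination -h0)
  -- ### `x - z = π γ^q ε` with `π ∤ γ` ([Schoof2009, Thm 7.2 (proof)], `h_p = 1`)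
  obtain ⟨𝔞f, h𝔞f⟩ := span_sub_zeta_pow_eq hζ hq hpo hqo hx hy h
  obtain ⟨hA, hcopA⟩ := h𝔞f 1 (mem_Ico.mpr ⟨le_rfl, hp.out.one_lt⟩)
  rw [pow_one, ← hzdef] at hA
  rw [← hzdef] at hcopA
  obtain ⟨γ, hγ⟩ : ∃ γ : 𝓞 K, 𝔞f 1 = Ideal.span {γ} :=
    ⟨_, (Ideal.span_singleton_generator (𝔞f 1)).symm⟩
  rw [hγ, Ideal.span_singleton_pow, Ideal.span_singleton_mul_span_singleton,
    Ideal.span_singleton_eq_span_singleton] at hA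
  obtain ⟨u, hu⟩ := hA
  rw [hγ, Ideal.isCoprime_span_singleton_iff] at hcopA
  have hπγ : ¬ π ∣ γ := fun hd => hπ.not_unit (hcopA.isUnit_of_dvd' dvd_rfl hd)
  set e : (𝓞 K)ˣ := u⁻¹ with hedef
  set ε : 𝓞 K := (e : 𝓞 K) with hεdef
  have hE : (x : 𝓞 K) - z = π * γ ^ q * ε := by
    rw [hεdef, hedef, ← hu, Units.mul_inv_cancel_right]
  -- ### complex conjugation, `ε = μ₀ · cc ε`, `ρ^q = -z μ₀` ([Schoof2009, Lemma 7.1, Cor. 8.4])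
  haveI : IsCMField K :=
    IsCyclotomicExtension.Rat.isCMField K (S := {p}) ⟨p, Set.mem_singleton p, by omega⟩
  set cc : 𝓞 K →+* 𝓞 K :=
    (RingOfIntegers.mapRingEquiv (IsCMField.complexConj K).toRingEquiv).toRingHom with hccdef
  have hccz : cc z = z ^ k := by
    apply RingOfIntegers.ext
    have h1 : (ζ ^ k) * ζ = 1 := by rw [← pow_succ, ← hk, hζ.pow_eq_one]
    calc ((cc z : 𝓞 K) : K) = IsCMField.complexConj K ζ := rfl
      _ = ζ⁻¹ := complexConj_zeta hζ
      _ = ζ ^ k := (eq_inv_of_mul_eq_one_left h1).symm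
      _ = ((z ^ k : 𝓞 K) : K) := by
        rw [RingOfIntegers.coe_eq_algebraMap, map_pow, ← RingOfIntegers.coe_eq_algebraMap]; rfl
  have hccx : cc (x : 𝓞 K) = x := map_intCast cc x
  have hccπ : cc π = -z ^ k * π := by
    rw [hπdef, map_sub, map_one, hccz]
    linear_combination hzk
  set μ₀ : 𝓞 K := ((IsCMField.unitsMulComplexConjInv K e : (𝓞 K)ˣ) : 𝓞 K) with hμ₀def
  have hμ2p : μ₀ ^ (2 * p) = 1 :=
    pow_two_mul_eq_one_of_mem_torsion hpo (IsCMField.unitsMulComplexConjInv K e).2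
  have hεμ : ε = μ₀ * cc ε := by
    have h1 : ((IsCMField.unitsMulComplexConjInv K e : (𝓞 K)ˣ)) * IsCMField.unitsComplexConj K e
        = e := by
      rw [IsCMField.unitsMulComplexConjInv_apply, inv_mul_cancel_right]
    have h2 := congrArg Units.val h1
    rw [Units.val_mul] at h2
    calc ε = _ := h2.symm
      _ = μ₀ * cc ε := rfl
  obtain ⟨s, -, hs⟩ := Nat.exists_mul_mod_eq_one_of_coprime hcop2p h2p
  have hν2p : (-z * μ₀) ^ (2 * p) = 1 := by
    rw [mul_pow, hμ2p, mul_one, neg_pow, Even.neg_one_pow ⟨p, two_mul p⟩, one_mul, pow_mul',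
      hzp, one_pow]
  set ρ : 𝓞 K := (-z * μ₀) ^ s with hρdef
  have hρq : ρ ^ q = -z * μ₀ := by
    rw [hρdef, ← pow_mul, mul_comm s q, ← Nat.div_add_mod (q * s) (2 * p), hs, pow_add,
      pow_mul, hν2p, one_pow, one_mul, pow_one]
  have hρ2p : ρ ^ (2 * p) = 1 := by rw [hρdef, ← pow_mul, mul_comm s (2 * p), pow_mul, hν2p, one_pow]
  set θ : 𝓞 K := ρ ^ (2 * p - 1) with hθdef
  have hρθ : ρ * θ = 1 := by rw [hθdef, ← pow_succ', Nat.sub_add_cancel (by omega), hρ2p]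
  clear_value cc μ₀ ρ θ
  -- ### `1 + μ = -ε γ^q`, `μ - z⁻¹ = z⁻¹ · cc ε · (cc γ)^q`, and the unit `ξ = ργ - cc γ`
  have hA1 : 1 + μ = -ε * γ ^ q := by
    apply mul_left_cancel₀ h1z
    have h1 : (1 - z) * (1 + μ) = (x : 𝓞 K) - z := by linear_combination hμ
    rw [h1, hE, hπdef]
    ring
  have hA2 : μ - z ^ k = z ^ k * cc ε * cc γ ^ q := by
    apply mul_left_cancel₀ h1z
    have h1 : (1 - z) * (μ - z ^ k) = (x : 𝓞 K) - z ^ k := by linear_combination hμ + hzk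
    have h2 : (x : 𝓞 K) - z ^ k = -z ^ k * π * cc γ ^ q * cc ε := by
      rw [← hccπ, ← map_pow, ← map_mul, ← map_mul, ← hE, map_sub, hccx, hccz]
    rw [h1, h2, hπdef]
    ring
  have hndvd : ¬ π ∣ 1 + μ := by
    rw [hA1]
    intro hd
    rcases hπ.dvd_or_dvd hd with h1 | h1
    · exact hπ.not_unit (isUnit_of_dvd_unit h1 e.isUnit.neg)
    · exact hπγ (hπ.dvd_of_dvd_pow h1)
  obtain ⟨w, hw⟩ := exists_pow_sub_dvd hζ hp2 hq hpq hqp1 M hndvd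
  obtain ⟨a₀, γinv, haγ⟩ := hcopA.pow_left (m := M)
  set ξ : 𝓞 K := ρ * γ - cc γ with hξdef
  have h1pz : IsUnit (1 + z) := by
    obtain ⟨v, hv⟩ := hz.associated_sub_one_pow_sub_one_of_coprime (Nat.coprime_two_left.mpr hpo)
    have hv' : (v : 𝓞 K) = 1 + z := by
      refine mul_left_cancel₀ hπ.ne_zero ?_
      rw [hπdef, hv]
      ring
    rw [← hv']
    exact v.isUnit
  have hsharp : cc ε * ((ρ * γ) ^ q - cc γ ^ q) = 1 + z := by
    linear_combination (cc ε * γ ^ q) * hρq + (z * γ ^ q) * hεμ - z * hA1 + z * hA2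
      + (1 + cc ε * cc γ ^ q) * hzk
  have hξu : IsUnit ξ := by
    have h1 : IsUnit ((ρ * γ) ^ q - cc γ ^ q) := by
      refine isUnit_of_mul_isUnit_right (x := cc ε) ?_
      rw [hsharp]
      exact h1pz
    exact isUnit_of_dvd_unit (sub_dvd_pow_sub_pow (ρ * γ) (cc γ) q) h1
  have hηu : IsUnit (ξ ^ q * z ^ k * cc ε) :=
    ((hξu.pow q).mul ((hz.isUnit hp.out.ne_zero).pow k)).mul (e.isUnit.map cc)
  obtain ⟨d, hd⟩ : ∃ d : 𝓞 K, d = 1 - cc γ * γinv * θ := ⟨_, rfl⟩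
  refine ⟨hηu.unit, w, w * cc γ * γinv * θ, ?_, hw, ?_, ?_⟩
  · rw [IsUnit.unit_spec]
    exact norm_eq_one_of_isUnit hζ hp2 hηu
  -- ### verification of the congruences in `𝓞 K ⧸ (π^M)` ([Schoof2009, Prop. 8.1])
  all_goals
    set mk : 𝓞 K →+* 𝓞 K ⧸ Ideal.span {π ^ M} := Ideal.Quotient.mk (Ideal.span {π ^ M})
      with hmkdef
    have hR : ∀ {a b : 𝓞 K}, π ^ M ∣ a - b ↔ mk a = mk b := fun {a b} => by
      rw [hmkdef, Ideal.Quotient.eq, Ideal.mem_span_singleton]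
    have HW : mk w ^ q = -mk ε * mk γ ^ q := by
      have h1 := hw
      rw [hA1, hR, map_pow, map_mul, map_neg, map_pow] at h1
      exact h1
    have HG1 : mk γ * mk γinv = 1 := by
      rw [← map_mul, ← map_one mk, ← hR]
      exact ⟨-a₀, by linear_combination haγ⟩
    have HG : mk γ ^ q * mk γinv ^ q = 1 := by rw [← mul_pow, HG1, one_pow]
    have Hε : mk ε = mk μ₀ * mk (cc ε) := by rw [← map_mul, ← hεμ]
    have Hρ : mk ρ ^ q = -mk z * mk μ₀ := by rw [← map_pow, hρq, map_mul, map_neg]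
    have Hθ : mk ρ * mk θ = 1 := by rw [← map_mul, hρθ, map_one]
    have Hθq : mk ρ ^ q * mk θ ^ q = 1 := by rw [← mul_pow, Hθ, one_pow]
    have Hz : mk z ^ k * mk z = 1 := by rw [← map_pow, ← map_mul, hzk, map_one]
  · rw [hA2, hR]
    simp only [map_pow, map_mul]
    linear_combination (mk (cc γ) ^ q * mk γinv ^ q * mk θ ^ q) * HW
      - (mk ε * mk (cc γ) ^ q * mk θ ^ q) * HG - (mk (cc γ) ^ q * mk θ ^ q) * Hε
      + (mk (cc ε) * mk (cc γ) ^ q * mk μ₀ * mk θ ^ q) * Hz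
      - (mk (cc ε) * mk (cc γ) ^ q * mk z ^ k * mk θ ^ q) * Hρ
      + (mk (cc ε) * mk (cc γ) ^ q * mk z ^ k) * Hθq
  · have hδ : w - w * cc γ * γinv * θ = w * d := by rw [hd]; ring
    have HΞ : mk ξ = mk ρ * mk γ * mk d := by
      rw [hξdef, hd, map_sub, map_mul, map_sub, map_one, map_mul, map_mul]
      linear_combination (mk (cc γ) * mk γ * mk γinv) * Hθ + mk (cc γ) * HG1
    have HΞq : mk ξ ^ q = mk ρ ^ q * mk γ ^ q * mk d ^ q := by rw [HΞ, mul_pow, mul_pow]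
    rw [IsUnit.unit_spec, hδ, hR]
    simp only [map_pow, map_mul]
    linear_combination mk d ^ q * HW - (mk z ^ k * mk (cc ε)) * HΞq
      - (mk z ^ k * mk (cc ε) * mk γ ^ q * mk d ^ q) * Hρ
      + (mk μ₀ * mk (cc ε) * mk γ ^ q * mk d ^ q) * Hz - (mk γ ^ q * mk d ^ q) * Hε

end Catalan

end Literature.NumberTheory.DiophantineGeometry
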